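import Literature.Analysis.FluidPDE.CollisionCylinder
import Literature.Analysis.FluidPDE.HardSphereScattering
import Literature.Analysis.FluidPDE.BBGKYMarginalsProofs
import HarnessLib

/-!
# The boundary flux of the hard-sphere phase space: Lebesgue measure near a contact in
# collision coordinates (old particles, impact direction, velocity, flight time)
(Cercignani–Illner–Pulvirenti 1994 App. 4.A pp. 107–111, the special-flow representation of the
hard-sphere flow over its collision boundary, "`dx = ε^{d-1} |v · n| dσ dτ`"; Gallagher–Saint-
Raymond–Texier 2013 Ch. 5 and Simonella 2014 (the parametrisation of the BBGKY pseudo-trajectories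
is non-singular); Bodineau–Gallagher–Saint-Raymond 2016 p. 15; trunk T-KINETIC, topic
Analysis/FluidPDE (hard-sphere dynamics); layer B2 of the plan towards the inputs (S), (R), (Reg)
of `bodineau_gallagher_saintRaymond_linear_of_inputs` / `bgsr_linearBoltzmannApprox_of_inputs`.)

Adjoin to `s` hard spheres on `T^d` a new sphere in contact with sphere `i`, at `x_i + ε ν`
with velocity `w` (`lossConfig`), outgoing (`⟪w - v_i, ν⟫ > 0`), and let the whole configuration
fly freely for a time `τ > 0`. In terms of the configuration `W'` of the old particles at the END
of the flight, the result is `appendParticle W' (x'_i + (ε ν + τ u)) w`, `u = w - v'_i`: the new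
particle sits at the point `ε ν + τ u` of the collision cylinder of `CollisionCylinder` around
particle `i`. This file PROVES that Lebesgue measure on the `(s+1)`-particle phase space
dominates, on these configurations, the flux measure `ε^{d-1} ⟪u, ν⟫ dW' dw dσ(ν) dτ`:

* `lintegral_config_succ` — `∫ g dZ_{s+1} = ∫ dZ_s ∫ dz g(Z_s, z)` (`volume_preserving_appendMEquiv`);
* `lintegral_torus_ge_chart` — Haar measure on `T^d` dominates Lebesgue measure on a chart ball
  of radius `ρ < 1/2` around any point (`Torus.map_proj_volume_restrict_symCube`);
* `lintegral_chart_ge_cylinder` — inside the chart, Lebesgue measure dominates the flux measure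
  on the collision cylinder (`lintegral_collisionCylinder`);
* `lintegral_ge_boundaryFlux` — **the flux inequality**: for measurable `g ≥ 0` on
  `Config (s+1)`,
  `∫ g ≥ ∫ dW' ∫ dw ∫ dσ(ν) ∫_{τ>0} 1_{⟪u,ν⟫>0} ε^{d-1}⟪u,ν⟫ 1_{‖εν+τu‖≤ρ} g(appendParticle W' (x'_i + (εν + τu)) w)`;
* `ae_not_mem_of_boundaryFlux_null` — hence configurations obtained this way from a
  Lebesgue-null set of `(s+1)`-configurations come from a null set of parameters `(W', w, ν, τ)`
  (outgoing, `τ > 0`, inside the chart);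
* `freeFlight_lossConfig_torus`, `measurePreserving_freeFlight_shear`,
  `ae_not_mem_of_boundaryFlux_null_contact` — the same in the contact-time coordinates
  `(Z', w, ν, τ)`, `Z' = S_{-τ} W'` the old spheres at the contact time
  (`S_τ (lossConfig Z' i ν w)` is the configuration above; the shear `(Z', τ) ↦ (S_τ Z', τ)`
  preserves the product measure): the tool by which Lebesgue-almost-everywhere statements on
  `Config (s+1)` (Alexander's theorem, versions of marginals) are transported to the contact
  configurations read by the BBGKY collision operators.

## References

* C. Cercignani, R. Illner, M. Pulvirenti, *The Mathematical Theory of Dilute Gases*, Springer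
  (1994), App. 4.A pp. 107–111.
* I. Gallagher, L. Saint-Raymond, B. Texier, *From Newton to Boltzmann*, EMS (2013),
  arXiv:1208.5753, §4.3 (4.3.6), Ch. 5.
* T. Bodineau, I. Gallagher, L. Saint-Raymond, Invent. Math. 203 (2016), arXiv:1305.3397v2, §5.1
  p. 15.
-/

open MeasureTheory MeasureTheory.Measure Metric Real Set Filter Function Module
open scoped ENNReal InnerProductSpace Topology

namespace Literature.Analysis.FluidPDE

noncomputable section

section Kinetic

variable {d : Type*} [Fintype d]

/-! ## §1. Integrating out the last particle -/

/-- **Integrating out the last particle**: for measurable `g ≥ 0` on `Config (s + 1)`,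
`∫ g dZ_{s+1} = ∫ dZ_s ∫ dz g (appendParticle Z_s z)` (juxtaposition of tuples is
measure-preserving, `volume_preserving_appendMEquiv`, and `Fin 1 → α ≃ α`). [folklore] -/
theorem lintegral_config_succ {X : Type*} [MeasureSpace X] [SigmaFinite (volume : Measure X)] {s : ℕ}
    (g : Config (s + 1) d X → ℝ≥0∞) (hg : Measurable g) :
    ∫⁻ W, g W = ∫⁻ Zs : Config s d X, ∫⁻ z : X × EuclideanSpace ℝ d, g (appendParticle Zs z.1 z.2) := by
  have h1 := (volume_preserving_appendMEquiv (X × EuclideanSpace ℝ d) s 1).lintegral_comp hg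
  simp only [appendMEquiv_apply] at h1
  have hmeas : Measurable fun p : Config s d X × (Fin 1 → X × EuclideanSpace ℝ d) => g (Fin.append p.1 p.2) := by
    have heq : (fun p : Config s d X × (Fin 1 → X × EuclideanSpace ℝ d) => g (Fin.append p.1 p.2)) =
        g ∘ appendMEquiv (X × EuclideanSpace ℝ d) s 1 := by
      funext p; simp [appendMEquiv_apply]
    rw [heq]
    exact hg.comp (appendMEquiv (X × EuclideanSpace ℝ d) s 1).measurable
  rw [← h1, lintegral_prod (fun p : Config s d X × (Fin 1 → X × EuclideanSpace ℝ d) => g (Fin.append p.1 p.2))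
    hmeas.aemeasurable]
  refine lintegral_congr fun Zs => ?_
  have h2 := (volume_preserving_funUnique (Fin 1) (X × EuclideanSpace ℝ d)).lintegral_comp
    (f := fun z : X × EuclideanSpace ℝ d => g (appendParticle Zs z.1 z.2))
    (hg.comp (measurable_appendParticle measurable_const measurable_fst measurable_snd))
  rw [← h2]
  refine lintegral_congr fun y => ?_
  have hy : y = ![y 0] := by
    funext j
    fin_cases j
    rfl
  conv_lhs => rw [hy]
  rfl

/-! ## §2. The chart around a point of the torus -/

/-- **Haar measure on `T^d` dominates Lebesgue measure on a chart ball**: for measurable `H ≥ 0`,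
`a ∈ T^d` and `ρ < 1/2`, `∫ H dx ≥ ∫_{‖r‖ ≤ ρ} H (a + proj r) dr` (translation invariance and
`Torus.map_proj_volume_restrict_symCube`: `proj` maps Lebesgue measure on the cube
`(-1/2, 1/2]^d ⊇ B̄(0, ρ)` to Haar measure). [folklore] -/
theorem lintegral_torus_ge_chart (H : UnitAddTorus d → ℝ≥0∞) (hH : Measurable H) (a : UnitAddTorus d)
    {ρ : ℝ} (hρ : ρ < 1 / 2) :
    ∫⁻ r in closedBall (0 : EuclideanSpace ℝ d) ρ, H (a + FunctionSpaces.Torus.proj r) ≤ ∫⁻ x, H x := by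
  have h1 : ∫⁻ x, H x = ∫⁻ x, H (x + a) := (lintegral_add_right_eq_self H a).symm
  have h2 : ∫⁻ x, H (x + a) = ∫⁻ r in Torus.symCube d, H (FunctionSpaces.Torus.proj r + a) := by
    have hm : Measurable fun x : UnitAddTorus d => H (x + a) := hH.comp (measurable_add_const a)
    rw [← Torus.map_proj_volume_restrict_symCube, lintegral_map hm FunctionSpaces.Torus.measurable_proj]
  rw [h1, h2]
  calc ∫⁻ r in closedBall (0 : EuclideanSpace ℝ d) ρ, H (a + FunctionSpaces.Torus.proj r)
      = ∫⁻ r in closedBall (0 : EuclideanSpace ℝ d) ρ, H (FunctionSpaces.Torus.proj r + a) := by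
        simp only [add_comm]
    _ ≤ ∫⁻ r in Torus.symCube d, H (FunctionSpaces.Torus.proj r + a) :=
        lintegral_mono_set (Torus.closedBall_subset_symCube hρ)

/-! ## §3. The flux on the collision cylinder inside the chart -/

/-- **Lebesgue measure on the chart ball dominates the flux measure on the collision cylinder**:
for measurable `K ≥ 0` on `ℝ^d`, `ε > 0` and `u ∈ ℝ^d`,
`∫_{‖r‖≤ρ} K ≥ ∫ dσ(ν) ∫_{τ>0} 1_{⟪u,ν⟫>0} ε^{d-1} ⟪u, ν⟫ 1_{‖εν+τu‖≤ρ} K(εν + τu)`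
(`lintegral_collisionCylinder` applied to `1_{B̄(0,ρ)} K`). [cite: CIP1994, App. 4.A p. 108] -/
theorem lintegral_chart_ge_cylinder [Nonempty d] (K : EuclideanSpace ℝ d → ℝ≥0∞) (hK : Measurable K)
    {ε : ℝ} (hε : 0 < ε) (u : EuclideanSpace ℝ d) (ρ : ℝ) :
    ∫⁻ ν : sphere (0 : EuclideanSpace ℝ d) 1, ∫⁻ τ in Ioi (0 : ℝ),
        (collisionCylDom u).indicator (fun _ => (1 : ℝ≥0∞)) (ν : EuclideanSpace ℝ d) *
          (ENNReal.ofReal (ε ^ (Fintype.card d - 1) * ⟪u, (ν : EuclideanSpace ℝ d)⟫_ℝ) *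
            ((closedBall (0 : EuclideanSpace ℝ d) ρ).indicator K (ε • (ν : EuclideanSpace ℝ d) + τ • u)))
          ∂volume ∂(volume : Measure (EuclideanSpace ℝ d)).toSphere ≤
      ∫⁻ r in closedBall (0 : EuclideanSpace ℝ d) ρ, K r := by
  have hfin : finrank ℝ (EuclideanSpace ℝ d) = Fintype.card d := finrank_euclideanSpace
  have key := lintegral_collisionCylinder (volume : Measure (EuclideanSpace ℝ d)) hε u
    ((closedBall (0 : EuclideanSpace ℝ d) ρ).indicator K) (hK.indicator measurableSet_closedBall)
  rw [hfin] at key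
  rw [← key, ← lintegral_indicator measurableSet_closedBall]
  exact setLIntegral_le_lintegral _ _

/-! ## §4. The flux inequality -/

/-- **The flux inequality** (CIP 1994 App. 4.A: Lebesgue measure near the collision boundary in
the coordinates of the special flow). For `s` spheres on `T^d`, a label `i`, a radius `ε > 0`, a
chart radius `ρ < 1/2` and measurable `g ≥ 0` on `Config (s + 1)`:
`∫ g dZ_{s+1} ≥ ∫ dW' ∫ dw ∫ dσ(ν) ∫_{τ>0} 1_{⟪u,ν⟫>0} ε^{d-1} ⟪u, ν⟫ 1_{‖εν+τu‖≤ρ}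
g (appendParticle W' (x'_i + proj (εν + τu)) w)`, `u = w - v'_i` — the configurations on the
right are those obtained by adjoining to `S_{-τ} W'` a sphere in outgoing contact with sphere
`i` (direction `ν`, velocity `w`) and flying freely for the time `τ`, read in terms of the
end configuration `W'` of the old spheres. Proof: integrate out the last particle
(`lintegral_config_succ`), pass to the chart around `x'_i` (`lintegral_torus_ge_chart`) and to
collision-cylinder coordinates in the chart (`lintegral_chart_ge_cylinder`).
[cite: CIP1994, App. 4.A pp. 108–111] -/
theorem lintegral_ge_boundaryFlux [Nonempty d] {s : ℕ} (i : Fin s) {ε : ℝ} (hε : 0 < ε) {ρ : ℝ} (hρ : ρ < 1 / 2)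
    (g : Config (s + 1) d (UnitAddTorus d) → ℝ≥0∞) (hg : Measurable g) :
    ∫⁻ W' : Config s d (UnitAddTorus d), ∫⁻ w : EuclideanSpace ℝ d,
        ∫⁻ ν : sphere (0 : EuclideanSpace ℝ d) 1, ∫⁻ τ in Ioi (0 : ℝ),
          (collisionCylDom (w - (W' i).2)).indicator (fun _ => (1 : ℝ≥0∞)) (ν : EuclideanSpace ℝ d) *
            (ENNReal.ofReal (ε ^ (Fintype.card d - 1) * ⟪w - (W' i).2, (ν : EuclideanSpace ℝ d)⟫_ℝ) *
              ((closedBall (0 : EuclideanSpace ℝ d) ρ).indicator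
                (fun r => g (appendParticle W' ((W' i).1 + FunctionSpaces.Torus.proj r) w))
                (ε • (ν : EuclideanSpace ℝ d) + τ • (w - (W' i).2))))
          ∂volume ∂(volume : Measure (EuclideanSpace ℝ d)).toSphere ≤
      ∫⁻ W, g W := by
  rw [lintegral_config_succ g hg]
  refine lintegral_mono fun W' => ?_
  have hgz : Measurable fun z : UnitAddTorus d × EuclideanSpace ℝ d => g (appendParticle W' z.1 z.2) :=
    hg.comp (measurable_appendParticle measurable_const measurable_fst measurable_snd)
  rw [Measure.volume_eq_prod, lintegral_prod _ hgz.aemeasurable]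
  conv_rhs => rw [lintegral_lintegral_swap hgz.aemeasurable]
  refine lintegral_mono fun w => ?_
  have hK : Measurable fun r : EuclideanSpace ℝ d =>
      g (appendParticle W' ((W' i).1 + FunctionSpaces.Torus.proj r) w) :=
    hg.comp (measurable_appendParticle measurable_const
      (measurable_const.add FunctionSpaces.Torus.measurable_proj) measurable_const)
  have hH : Measurable fun x : UnitAddTorus d => g (appendParticle W' x w) :=
    hg.comp (measurable_appendParticle measurable_const measurable_id measurable_const)
  exact (lintegral_chart_ge_cylinder _ hK hε (w - (W' i).2) ρ).trans
    (lintegral_torus_ge_chart _ hH (W' i).1 hρ)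

/-! ## §5. Null sets of parameters from null sets of configurations -/

/-- **Null sets are transported from the phase space to the collision coordinates.** If
`T ⊆ Config (s + 1)` is Lebesgue-null, then for almost every `W'`, almost every `w`, and
`σ ⊗ dτ`-almost every `(ν, τ)`, it is NOT the case that `(ν, τ)` are outgoing collision
coordinates inside the chart (`⟪w - v'_i, ν⟫ > 0`, `τ > 0`, `‖εν + τ(w - v'_i)‖ ≤ ρ`) of a
configuration `appendParticle W' (x'_i + proj (εν + τ(w - v'_i))) w ∈ T`: the flux inequality
for `g = 1_T` and positivity of the flux weight. [cite: CIP1994, App. 4.A pp. 108–111] -/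
theorem ae_not_mem_of_boundaryFlux_null [Nonempty d] {s : ℕ} (i : Fin s) {ε : ℝ} (hε : 0 < ε) {ρ : ℝ}
    (hρ : ρ < 1 / 2) {T : Set (Config (s + 1) d (UnitAddTorus d))} (hTm : MeasurableSet T) (hT : volume T = 0) :
    ∀ᵐ W' : Config s d (UnitAddTorus d), ∀ᵐ w : EuclideanSpace ℝ d,
      ∀ᵐ q : sphere (0 : EuclideanSpace ℝ d) 1 × ℝ ∂((volume : Measure (EuclideanSpace ℝ d)).toSphere.prod volume),
        ¬ (0 < ⟪w - (W' i).2, (q.1 : EuclideanSpace ℝ d)⟫_ℝ ∧ 0 < q.2 ∧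
            ε • (q.1 : EuclideanSpace ℝ d) + q.2 • (w - (W' i).2) ∈ closedBall (0 : EuclideanSpace ℝ d) ρ ∧
            appendParticle W' ((W' i).1 +
              FunctionSpaces.Torus.proj (ε • (q.1 : EuclideanSpace ℝ d) + q.2 • (w - (W' i).2))) w ∈ T) := by
  classical
  have key := lintegral_ge_boundaryFlux i hε hρ (T.indicator fun _ => (1 : ℝ≥0∞)) (measurable_one.indicator hTm)
  have h0 : ∫⁻ W, T.indicator (fun _ => (1 : ℝ≥0∞)) W = 0 := by rw [lintegral_indicator hTm]; simp [hT]
  rw [h0, nonpos_iff_eq_zero] at key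
  -- the integrand as a function of all variables
  set F : Config s d (UnitAddTorus d) → EuclideanSpace ℝ d → sphere (0 : EuclideanSpace ℝ d) 1 × ℝ → ℝ≥0∞ :=
    fun W' w q => (Ioi (0 : ℝ)).indicator (fun τ =>
      (collisionCylDom (w - (W' i).2)).indicator (fun _ => (1 : ℝ≥0∞)) (q.1 : EuclideanSpace ℝ d) *
        (ENNReal.ofReal (ε ^ (Fintype.card d - 1) * ⟪w - (W' i).2, (q.1 : EuclideanSpace ℝ d)⟫_ℝ) *
          ((closedBall (0 : EuclideanSpace ℝ d) ρ).indicator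
            (fun r => T.indicator (fun _ => (1 : ℝ≥0∞)) (appendParticle W' ((W' i).1 + FunctionSpaces.Torus.proj r) w))
            (ε • (q.1 : EuclideanSpace ℝ d) + τ • (w - (W' i).2))))) q.2 with hF
  -- joint measurability
  have hFm : Measurable fun p : Config s d (UnitAddTorus d) × EuclideanSpace ℝ d × (sphere (0 : EuclideanSpace ℝ d) 1 × ℝ) =>
      F p.1 p.2.1 p.2.2 := by
    have hu : Measurable fun p : Config s d (UnitAddTorus d) × EuclideanSpace ℝ d × (sphere (0 : EuclideanSpace ℝ d) 1 × ℝ) =>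
        p.2.1 - (p.1 i).2 := measurable_snd.fst.sub ((measurable_pi_apply i).comp measurable_fst).snd
    have hν : Measurable fun p : Config s d (UnitAddTorus d) × EuclideanSpace ℝ d × (sphere (0 : EuclideanSpace ℝ d) 1 × ℝ) =>
        (p.2.2.1 : EuclideanSpace ℝ d) := measurable_subtype_coe.comp measurable_snd.snd.fst
    have hτ : Measurable fun p : Config s d (UnitAddTorus d) × EuclideanSpace ℝ d × (sphere (0 : EuclideanSpace ℝ d) 1 × ℝ) =>
        p.2.2.2 := measurable_snd.snd.snd
    have hr : Measurable fun p : Config s d (UnitAddTorus d) × EuclideanSpace ℝ d × (sphere (0 : EuclideanSpace ℝ d) 1 × ℝ) =>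
        ε • (p.2.2.1 : EuclideanSpace ℝ d) + p.2.2.2 • (p.2.1 - (p.1 i).2) := (hν.const_smul ε).add (hτ.smul hu)
    have hc : Measurable fun p : Config s d (UnitAddTorus d) × EuclideanSpace ℝ d × (sphere (0 : EuclideanSpace ℝ d) 1 × ℝ) =>
        (collisionCylDom (p.2.1 - (p.1 i).2)).indicator (fun _ => (1 : ℝ≥0∞)) (p.2.2.1 : EuclideanSpace ℝ d) := by
      have : (fun p : Config s d (UnitAddTorus d) × EuclideanSpace ℝ d × (sphere (0 : EuclideanSpace ℝ d) 1 × ℝ) =>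
          (collisionCylDom (p.2.1 - (p.1 i).2)).indicator (fun _ => (1 : ℝ≥0∞)) (p.2.2.1 : EuclideanSpace ℝ d)) =
          fun p => if 0 < ⟪p.2.1 - (p.1 i).2, (p.2.2.1 : EuclideanSpace ℝ d)⟫_ℝ then 1 else 0 := by
        funext p; simp only [Set.indicator_apply, mem_collisionCylDom]
      rw [this]
      exact Measurable.ite (measurableSet_lt measurable_const (hu.inner hν)) measurable_const measurable_const
    have hd : Measurable fun p : Config s d (UnitAddTorus d) × EuclideanSpace ℝ d × (sphere (0 : EuclideanSpace ℝ d) 1 × ℝ) =>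
        ENNReal.ofReal (ε ^ (Fintype.card d - 1) * ⟪p.2.1 - (p.1 i).2, (p.2.2.1 : EuclideanSpace ℝ d)⟫_ℝ) :=
      (measurable_const.mul (hu.inner hν)).ennreal_ofReal
    have happ : Measurable fun p : Config s d (UnitAddTorus d) × EuclideanSpace ℝ d × (sphere (0 : EuclideanSpace ℝ d) 1 × ℝ) =>
        appendParticle p.1 ((p.1 i).1 + FunctionSpaces.Torus.proj (ε • (p.2.2.1 : EuclideanSpace ℝ d) + p.2.2.2 • (p.2.1 - (p.1 i).2))) p.2.1 :=
      measurable_appendParticle measurable_fst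
        (((measurable_pi_apply i).comp measurable_fst).fst.add (FunctionSpaces.Torus.measurable_proj.comp hr))
        measurable_snd.fst
    have he : Measurable fun p : Config s d (UnitAddTorus d) × EuclideanSpace ℝ d × (sphere (0 : EuclideanSpace ℝ d) 1 × ℝ) =>
        (closedBall (0 : EuclideanSpace ℝ d) ρ).indicator
          (fun r => T.indicator (fun _ => (1 : ℝ≥0∞)) (appendParticle p.1 ((p.1 i).1 + FunctionSpaces.Torus.proj r) p.2.1))
          (ε • (p.2.2.1 : EuclideanSpace ℝ d) + p.2.2.2 • (p.2.1 - (p.1 i).2)) := by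
      have : (fun p : Config s d (UnitAddTorus d) × EuclideanSpace ℝ d × (sphere (0 : EuclideanSpace ℝ d) 1 × ℝ) =>
          (closedBall (0 : EuclideanSpace ℝ d) ρ).indicator
            (fun r => T.indicator (fun _ => (1 : ℝ≥0∞)) (appendParticle p.1 ((p.1 i).1 + FunctionSpaces.Torus.proj r) p.2.1))
            (ε • (p.2.2.1 : EuclideanSpace ℝ d) + p.2.2.2 • (p.2.1 - (p.1 i).2))) =
          fun p => if ε • (p.2.2.1 : EuclideanSpace ℝ d) + p.2.2.2 • (p.2.1 - (p.1 i).2) ∈ closedBall (0 : EuclideanSpace ℝ d) ρ then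
            T.indicator (fun _ => (1 : ℝ≥0∞))
              (appendParticle p.1 ((p.1 i).1 + FunctionSpaces.Torus.proj (ε • (p.2.2.1 : EuclideanSpace ℝ d) + p.2.2.2 • (p.2.1 - (p.1 i).2))) p.2.1)
            else 0 := by
        funext p; simp only [Set.indicator_apply]
      rw [this]
      exact Measurable.ite (measurableSet_closedBall.preimage hr) ((measurable_one.indicator hTm).comp happ) measurable_const
    have hprod := hc.mul (hd.mul he)
    have : (fun p : Config s d (UnitAddTorus d) × EuclideanSpace ℝ d × (sphere (0 : EuclideanSpace ℝ d) 1 × ℝ) => F p.1 p.2.1 p.2.2) =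
        fun p => if p.2.2.2 ∈ Ioi (0 : ℝ) then
          (collisionCylDom (p.2.1 - (p.1 i).2)).indicator (fun _ => (1 : ℝ≥0∞)) (p.2.2.1 : EuclideanSpace ℝ d) *
            (ENNReal.ofReal (ε ^ (Fintype.card d - 1) * ⟪p.2.1 - (p.1 i).2, (p.2.2.1 : EuclideanSpace ℝ d)⟫_ℝ) *
              (closedBall (0 : EuclideanSpace ℝ d) ρ).indicator
                (fun r => T.indicator (fun _ => (1 : ℝ≥0∞)) (appendParticle p.1 ((p.1 i).1 + FunctionSpaces.Torus.proj r) p.2.1))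
                (ε • (p.2.2.1 : EuclideanSpace ℝ d) + p.2.2.2 • (p.2.1 - (p.1 i).2))) else 0 := by
      funext p; rw [hF]; simp only [Set.indicator_apply]
    rw [this]
    exact Measurable.ite (measurableSet_Ioi.preimage hτ) hprod measurable_const
  -- the iterated integral of `F` vanishes
  have hint : ∫⁻ W', ∫⁻ w, ∫⁻ q, F W' w q ∂((volume : Measure (EuclideanSpace ℝ d)).toSphere.prod volume) = 0 := by
    rw [← key]
    refine lintegral_congr fun W' => lintegral_congr fun w => ?_
    have hFq : Measurable (F W' w) := hFm.comp (measurable_const.prodMk (measurable_const.prodMk measurable_id))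
    rw [lintegral_prod _ hFq.aemeasurable]
    refine lintegral_congr fun ν => ?_
    rw [← lintegral_indicator measurableSet_Ioi]
  -- hence `F = 0` almost everywhere, iteratively
  have hF2 : Measurable fun p : (Config s d (UnitAddTorus d) × EuclideanSpace ℝ d) × (sphere (0 : EuclideanSpace ℝ d) 1 × ℝ) =>
      F p.1.1 p.1.2 p.2 :=
    hFm.comp (measurable_fst.fst.prodMk (measurable_fst.snd.prodMk measurable_snd))
  have hF1 : Measurable fun p : Config s d (UnitAddTorus d) × EuclideanSpace ℝ d =>
      ∫⁻ q, F p.1 p.2 q ∂((volume : Measure (EuclideanSpace ℝ d)).toSphere.prod volume) :=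
    hF2.lintegral_prod_right'
  have hF0 : Measurable fun W' : Config s d (UnitAddTorus d) =>
      ∫⁻ w, ∫⁻ q, F W' w q ∂((volume : Measure (EuclideanSpace ℝ d)).toSphere.prod volume) :=
    hF1.lintegral_prod_right'
  have h1 : ∀ᵐ W' : Config s d (UnitAddTorus d),
      ∫⁻ w, ∫⁻ q, F W' w q ∂((volume : Measure (EuclideanSpace ℝ d)).toSphere.prod volume) = 0 :=
    (lintegral_eq_zero_iff hF0).1 hint
  filter_upwards [h1] with W' hW'
  have h2 : ∀ᵐ w : EuclideanSpace ℝ d, ∫⁻ q, F W' w q ∂((volume : Measure (EuclideanSpace ℝ d)).toSphere.prod volume) = 0 :=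
    (lintegral_eq_zero_iff (hF1.comp (measurable_const.prodMk measurable_id))).1 hW'
  filter_upwards [h2] with w hw
  have h3 : ∀ᵐ q ∂((volume : Measure (EuclideanSpace ℝ d)).toSphere.prod volume), F W' w q = 0 :=
    (lintegral_eq_zero_iff (hFm.comp (measurable_const.prodMk (measurable_const.prodMk measurable_id)))).1 hw
  filter_upwards [h3] with q hq
  rintro ⟨hflux, hτ, hball, hT⟩
  have hval : F W' w q = ENNReal.ofReal (ε ^ (Fintype.card d - 1) * ⟪w - (W' i).2, (q.1 : EuclideanSpace ℝ d)⟫_ℝ) := by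
    rw [hF]
    simp only
    rw [indicator_of_mem (show q.2 ∈ Ioi (0 : ℝ) from hτ),
      indicator_of_mem (show (q.1 : EuclideanSpace ℝ d) ∈ collisionCylDom (w - (W' i).2) from hflux),
      indicator_of_mem hball, indicator_of_mem hT, one_mul, mul_one]
  rw [hval] at hq
  have hpos : 0 < ENNReal.ofReal (ε ^ (Fintype.card d - 1) * ⟪w - (W' i).2, (q.1 : EuclideanSpace ℝ d)⟫_ℝ) :=
    ENNReal.ofReal_pos.2 (mul_pos (pow_pos hε _) hflux)
  exact hpos.ne' hq

/-! ## §6. Contact-time coordinates -/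

/-- **The adjoined sphere after a free flight, in terms of the end configuration of the old
spheres**: on `T^d`, flying freely for the time `τ` the configuration obtained by adjoining to
`Z'` a sphere at `x_i + ε ν` with velocity `w` (`lossConfig`) gives the configuration obtained by
adjoining to `W' = S_τ Z'` a sphere at `x'_i + (ε ν + τ (w - v_i))` with velocity `w`
(additivity of the covering map `proj`). [folklore] -/
theorem freeFlight_lossConfig_torus {s : ℕ} (Z' : Config s d (UnitAddTorus d)) (i : Fin s) (ε : ℝ)
    (ν w : EuclideanSpace ℝ d) (τ : ℝ) :
    freeFlight (Torus.geometry d) τ (lossConfig (Torus.geometry d) ε Z' i ν w) =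
      appendParticle (freeFlight (Torus.geometry d) τ Z')
        ((freeFlight (Torus.geometry d) τ Z' i).1 + FunctionSpaces.Torus.proj (ε • ν + τ • (w - (Z' i).2))) w := by
  funext j
  refine Fin.addCases (fun j => ?_) (fun j => ?_) j
  · simp [freeFlight, lossConfig, appendParticle]
  · obtain rfl : j = 0 := Subsingleton.elim _ _
    simp only [freeFlight, lossConfig, appendParticle, Fin.append_right, Matrix.cons_val_fin_one,
      Torus.geometry_translate]
    refine Prod.ext ?_ rfl
    simp only
    rw [add_assoc, add_assoc, ← FunctionSpaces.Torus.proj_add, ← FunctionSpaces.Torus.proj_add]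
    congr 2
    module

/-- The shear `(Z', (w, ν, τ)) ↦ (S_τ Z', (w, ν, τ))` preserves the product of Lebesgue measure
on `Config s` with any s-finite measure on the parameters (free flight preserves volume for each
time, `measurePreserving_freeFlight_torusGeometry`; Mathlib's `MeasurePreserving.skew_product`). [folklore] -/
theorem measurePreserving_freeFlight_shear {s : ℕ} {P : Type*} [MeasurableSpace P] (κ : Measure P) [SFinite κ]
    {t : P → ℝ} (ht : Measurable t) :
    MeasurePreserving (fun p : Config s d (UnitAddTorus d) × P => (freeFlight (Torus.geometry d) (t p.2) p.1, p.2))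
      ((volume : Measure (Config s d (UnitAddTorus d))).prod κ) ((volume : Measure (Config s d (UnitAddTorus d))).prod κ) := by
  -- instance shortcuts (the search for `SigmaFinite` on configuration spaces is deep)
  haveI hXE : SigmaFinite (volume : Measure (UnitAddTorus d × EuclideanSpace ℝ d)) := inferInstance
  haveI hC : SigmaFinite (volume : Measure (Config s d (UnitAddTorus d))) := inferInstance
  have hsk : MeasurePreserving (fun p : P × Config s d (UnitAddTorus d) => (id p.1, freeFlight (Torus.geometry d) (t p.1) p.2))
      (κ.prod volume) (κ.prod volume) := by
    refine MeasurePreserving.skew_product (MeasurePreserving.id κ) ?_ (Eventually.of_forall fun a =>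
      (Alexander.measurePreserving_freeFlight_torusGeometry (t a)).map_eq)
    exact Torus.isMeasurable_geometry.measurable_freeFlight₂.comp ((ht.comp measurable_fst).prodMk measurable_snd)
  have h := (measurePreserving_swap (μ := κ) (ν := (volume : Measure (Config s d (UnitAddTorus d))))).comp
    (hsk.comp (measurePreserving_swap (μ := (volume : Measure (Config s d (UnitAddTorus d)))) (ν := κ)))
  exact h

/-- **Null sets are transported to the contact-time coordinates.** If `T ⊆ Config (s + 1)` is
Lebesgue-null, then for almost every configuration `Z'` of the old spheres at the contact
time, almost every velocity `w` and `σ ⊗ dτ`-almost every `(ν, τ)`, it is NOT the case that the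
adjoined sphere is outgoing (`⟪w - v_i, ν⟫ > 0`), `τ > 0`, the flight stays in the chart
(`‖εν + τ(w - v_i)‖ ≤ ρ`) and `S_τ (lossConfig Z' i ν w) ∈ T`: the form in which a Lebesgue-null
pathological set of `(s+1)`-configurations is seen from the collision integrals of the BBGKY
hierarchy ("`Ψ_{i+1}` is well defined up to a set of measure `0`", BGSR p. 15).
[cite: BodineauGallagherSaintRaymondInvent2016, §5.1 p. 15] -/
theorem ae_not_mem_of_boundaryFlux_null_contact [Nonempty d] {s : ℕ} (i : Fin s) {ε : ℝ} (hε : 0 < ε) {ρ : ℝ}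
    (hρ : ρ < 1 / 2) {T : Set (Config (s + 1) d (UnitAddTorus d))} (hTm : MeasurableSet T) (hT : volume T = 0) :
    ∀ᵐ Z' : Config s d (UnitAddTorus d), ∀ᵐ w : EuclideanSpace ℝ d,
      ∀ᵐ q : sphere (0 : EuclideanSpace ℝ d) 1 × ℝ ∂((volume : Measure (EuclideanSpace ℝ d)).toSphere.prod volume),
        ¬ (0 < ⟪w - (Z' i).2, (q.1 : EuclideanSpace ℝ d)⟫_ℝ ∧ 0 < q.2 ∧
            ε • (q.1 : EuclideanSpace ℝ d) + q.2 • (w - (Z' i).2) ∈ closedBall (0 : EuclideanSpace ℝ d) ρ ∧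
            freeFlight (Torus.geometry d) q.2 (lossConfig (Torus.geometry d) ε Z' i q.1 w) ∈ T) := by
  haveI hXE : SigmaFinite (volume : Measure (UnitAddTorus d × EuclideanSpace ℝ d)) := inferInstance
  haveI hC : SigmaFinite (volume : Measure (Config s d (UnitAddTorus d))) := inferInstance
  -- the parameter measure and the two sets
  set κ : Measure (EuclideanSpace ℝ d × (sphere (0 : EuclideanSpace ℝ d) 1 × ℝ)) :=
    (volume : Measure (EuclideanSpace ℝ d)).prod (((volume : Measure (EuclideanSpace ℝ d)).toSphere).prod volume) with hκ
  haveI hσf : IsFiniteMeasure ((volume : Measure (EuclideanSpace ℝ d)).toSphere) := inferInstance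
  haveI hσp : SFinite (((volume : Measure (EuclideanSpace ℝ d)).toSphere).prod (volume : Measure ℝ)) := inferInstance
  haveI hκs : SFinite κ := by rw [hκ]; infer_instance
  set S : Set (Config s d (UnitAddTorus d) × (EuclideanSpace ℝ d × (sphere (0 : EuclideanSpace ℝ d) 1 × ℝ))) :=
    {p | 0 < ⟪p.2.1 - (p.1 i).2, (p.2.2.1 : EuclideanSpace ℝ d)⟫_ℝ ∧ 0 < p.2.2.2 ∧
      ε • (p.2.2.1 : EuclideanSpace ℝ d) + p.2.2.2 • (p.2.1 - (p.1 i).2) ∈ closedBall (0 : EuclideanSpace ℝ d) ρ ∧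
      appendParticle p.1 ((p.1 i).1 +
        FunctionSpaces.Torus.proj (ε • (p.2.2.1 : EuclideanSpace ℝ d) + p.2.2.2 • (p.2.1 - (p.1 i).2))) p.2.1 ∈ T} with hS
  set S' : Set (Config s d (UnitAddTorus d) × (EuclideanSpace ℝ d × (sphere (0 : EuclideanSpace ℝ d) 1 × ℝ))) :=
    {p | 0 < ⟪p.2.1 - (p.1 i).2, (p.2.2.1 : EuclideanSpace ℝ d)⟫_ℝ ∧ 0 < p.2.2.2 ∧
      ε • (p.2.2.1 : EuclideanSpace ℝ d) + p.2.2.2 • (p.2.1 - (p.1 i).2) ∈ closedBall (0 : EuclideanSpace ℝ d) ρ ∧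
      freeFlight (Torus.geometry d) p.2.2.2 (lossConfig (Torus.geometry d) ε p.1 i p.2.2.1 p.2.1) ∈ T} with hS'
  -- measurability of the ingredients
  have hu : Measurable fun p : Config s d (UnitAddTorus d) × (EuclideanSpace ℝ d × (sphere (0 : EuclideanSpace ℝ d) 1 × ℝ)) =>
      p.2.1 - (p.1 i).2 := measurable_snd.fst.sub ((measurable_pi_apply i).comp measurable_fst).snd
  have hν : Measurable fun p : Config s d (UnitAddTorus d) × (EuclideanSpace ℝ d × (sphere (0 : EuclideanSpace ℝ d) 1 × ℝ)) =>
      (p.2.2.1 : EuclideanSpace ℝ d) := measurable_subtype_coe.comp measurable_snd.snd.fst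
  have hτ : Measurable fun p : Config s d (UnitAddTorus d) × (EuclideanSpace ℝ d × (sphere (0 : EuclideanSpace ℝ d) 1 × ℝ)) =>
      p.2.2.2 := measurable_snd.snd.snd
  have hr : Measurable fun p : Config s d (UnitAddTorus d) × (EuclideanSpace ℝ d × (sphere (0 : EuclideanSpace ℝ d) 1 × ℝ)) =>
      ε • (p.2.2.1 : EuclideanSpace ℝ d) + p.2.2.2 • (p.2.1 - (p.1 i).2) := (hν.const_smul ε).add (hτ.smul hu)
  have hcond : MeasurableSet {p : Config s d (UnitAddTorus d) × (EuclideanSpace ℝ d × (sphere (0 : EuclideanSpace ℝ d) 1 × ℝ)) |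
      0 < ⟪p.2.1 - (p.1 i).2, (p.2.2.1 : EuclideanSpace ℝ d)⟫_ℝ ∧ 0 < p.2.2.2 ∧
        ε • (p.2.2.1 : EuclideanSpace ℝ d) + p.2.2.2 • (p.2.1 - (p.1 i).2) ∈ closedBall (0 : EuclideanSpace ℝ d) ρ} := by
    rw [Set.setOf_and, Set.setOf_and]
    exact (measurableSet_lt (measurable_const : Measurable fun _ => (0 : ℝ)) (hu.inner hν)).inter
      ((measurableSet_lt (measurable_const : Measurable fun _ => (0 : ℝ)) hτ).inter (measurableSet_closedBall.preimage hr))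
  have happ : Measurable fun p : Config s d (UnitAddTorus d) × (EuclideanSpace ℝ d × (sphere (0 : EuclideanSpace ℝ d) 1 × ℝ)) =>
      appendParticle p.1 ((p.1 i).1 + FunctionSpaces.Torus.proj (ε • (p.2.2.1 : EuclideanSpace ℝ d) + p.2.2.2 • (p.2.1 - (p.1 i).2))) p.2.1 :=
    measurable_appendParticle measurable_fst
      (((measurable_pi_apply i).comp measurable_fst).fst.add (FunctionSpaces.Torus.measurable_proj.comp hr)) measurable_snd.fst
  have hloss : Measurable fun p : Config s d (UnitAddTorus d) × (EuclideanSpace ℝ d × (sphere (0 : EuclideanSpace ℝ d) 1 × ℝ)) =>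
      freeFlight (Torus.geometry d) p.2.2.2 (lossConfig (Torus.geometry d) ε p.1 i p.2.2.1 p.2.1) :=
    Torus.isMeasurable_geometry.measurable_freeFlight₂.comp
      (hτ.prodMk (measurable_lossConfig Torus.isMeasurable_geometry.measurable_translate ε i measurable_fst hν measurable_snd.fst))
  have hSm : MeasurableSet S := by
    have : S = {p | 0 < ⟪p.2.1 - (p.1 i).2, (p.2.2.1 : EuclideanSpace ℝ d)⟫_ℝ ∧ 0 < p.2.2.2 ∧
        ε • (p.2.2.1 : EuclideanSpace ℝ d) + p.2.2.2 • (p.2.1 - (p.1 i).2) ∈ closedBall (0 : EuclideanSpace ℝ d) ρ} ∩ (fun p => appendParticle p.1 ((p.1 i).1 + FunctionSpaces.Torus.proj (ε • (p.2.2.1 : EuclideanSpace ℝ d) + p.2.2.2 • (p.2.1 - (p.1 i).2))) p.2.1) ⁻¹' T := by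
      ext p; simp only [hS, mem_setOf_eq, mem_inter_iff, mem_preimage, and_assoc]
    rw [this]
    exact hcond.inter (hTm.preimage happ)
  have hS'm : MeasurableSet S' := by
    have : S' = {p | 0 < ⟪p.2.1 - (p.1 i).2, (p.2.2.1 : EuclideanSpace ℝ d)⟫_ℝ ∧ 0 < p.2.2.2 ∧
        ε • (p.2.2.1 : EuclideanSpace ℝ d) + p.2.2.2 • (p.2.1 - (p.1 i).2) ∈ closedBall (0 : EuclideanSpace ℝ d) ρ} ∩
        (fun p => freeFlight (Torus.geometry d) p.2.2.2 (lossConfig (Torus.geometry d) ε p.1 i p.2.2.1 p.2.1)) ⁻¹' T := by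
      ext p; simp only [hS', mem_setOf_eq, mem_inter_iff, mem_preimage, and_assoc]
    rw [this]
    exact hcond.inter (hTm.preimage hloss)
  -- `S'` is the preimage of `S` under the volume-preserving shear
  have hΘ := measurePreserving_freeFlight_shear (d := d) (s := s) κ
    (t := fun q : EuclideanSpace ℝ d × (sphere (0 : EuclideanSpace ℝ d) 1 × ℝ) => q.2.2) measurable_snd.snd
  have hpre : S' = (fun p : Config s d (UnitAddTorus d) × (EuclideanSpace ℝ d × (sphere (0 : EuclideanSpace ℝ d) 1 × ℝ)) =>
      (freeFlight (Torus.geometry d) p.2.2.2 p.1, p.2)) ⁻¹' S := by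
    ext p
    simp only [hS, hS', mem_setOf_eq, mem_preimage, freeFlight_lossConfig_torus, freeFlight_apply]
  -- the end-configuration statement, as a statement on the product space
  have hμ : ((volume : Measure (Config s d (UnitAddTorus d))).prod κ) S = 0 := by
    have h := ae_not_mem_of_boundaryFlux_null i hε hρ hTm hT
    rw [measure_eq_zero_iff_ae_notMem]
    refine (ae_prod_iff_ae_ae (μ := (volume : Measure (Config s d (UnitAddTorus d)))) (ν := κ)
      (p := (fun p => p ∉ S)) hSm.compl).2 ?_
    filter_upwards [h] with W' hW'
    rw [hκ]
    refine (ae_prod_iff_ae_ae (p := (fun y : EuclideanSpace ℝ d × (sphere (0 : EuclideanSpace ℝ d) 1 × ℝ) => (W', y) ∉ S))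
      ((hSm.preimage (measurable_const.prodMk measurable_id)).compl)).2 ?_
    filter_upwards [hW'] with w hw
    filter_upwards [hw] with q hq
    exact hq
  have hμ' : ((volume : Measure (Config s d (UnitAddTorus d))).prod κ) S' = 0 := by
    rw [hpre, hΘ.measure_preimage hSm.nullMeasurableSet]
    exact hμ
  -- back to the iterated form
  have hae := measure_eq_zero_iff_ae_notMem.1 hμ'
  rw [ae_prod_iff_ae_ae (μ := (volume : Measure (Config s d (UnitAddTorus d)))) (ν := κ)
    (p := (fun p => p ∉ S')) hS'm.compl] at hae
  filter_upwards [hae] with Z' hZ'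
  rw [hκ, ae_prod_iff_ae_ae (p := (fun y : EuclideanSpace ℝ d × (sphere (0 : EuclideanSpace ℝ d) 1 × ℝ) => (Z', y) ∉ S'))
    ((hS'm.preimage (measurable_const.prodMk measurable_id)).compl)] at hZ'
  filter_upwards [hZ'] with w hw
  filter_upwards [hw] with q hq
  exact hq

end Kinetic

end

end Literature.Analysis.FluidPDE
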